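import Mathlib

/-!
# Hodge-locus census — THE DUAL-DEGREE BOUND FOR A PENCIL OF MATRICES (PROPOSITION U)
(def-free helper of `stmt-HodgeConjecture-16267`; pub-hlocus, seat ivhs-2 = ENGINE B, gen 30; record
`pub-hlocus-ivhs-2/ENGINEB-g30.md` §3, programs `gen30/progU/dualU.py`, `gen29/progS/socleS.py`, `gen29/progT/pairT.py`)

Pure linear algebra behind the census `b`-column mechanism found in gen 30.  In the census, the pair locus of two
half-dimensional planes `P₁, P₂ ⊂ X = V(F) ⊂ ℙ^{n+1}` is studied through the pencil `C₁ + c·C₂` of the two catalecticant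
blocks of the socle functionals `φ₁, φ₂` (rows indexed by the degree-`d` monomials `R_d`, columns by the monomials of the DUAL
degree `t - d`, `t = (p+1)(d-2)`).  Every monomial of the common annihilator `I = Ann φ₁ ∩ Ann φ₂` in degree `t - d` is a common
RIGHT-kernel vector of `C₁` and `C₂`, and every element of `I_d` a common LEFT-kernel vector.  The two theorems below say that
for ANY pencil member `a•A + b•B`:

* `rank (a•A + b•B) + dim E ≤ #columns` for every subspace `E` killed on the right by both `A` and `B`
  (`rank_add_finrank_le_card_of_mulVec_eq_zero`) — in the census: generic pencil rank `g ≤ r' := HF_I(t-d)`;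
* `rank (a•A + b•B) + dim F ≤ #rows` for every subspace `F` killed on the left by both
  (`rank_add_finrank_le_card_of_vecMul_eq_zero`) — in the census: `g ≤ r := HF_I(d)`, the pair-locus codimension;

hence the excess `b = r - g ≥ r - r'` (`rank_le_min`, `excess_lower_bound`).  At all 35 random census members computed
exactly in gen 29/30 the excess EQUALS `max (0, r - r')`.

certified instances and evidence bearing on the general Hodge conjecture; no claim.
-/

namespace Summit.HodgeConjecture.HodgeConjecture.HodgeLocus.Census.DualDegree

open Matrix Module

variable {K : Type*} [Field K] {m n : Type*} [Fintype m] [Fintype n]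

omit [Fintype m] in
/-- A common right-kernel vector of `A` and `B` is killed by every pencil member. -/
theorem pencil_mulVec_eq_zero (A B : Matrix m n K) (a b : K) {e : n → K}
    (hA : A *ᵥ e = 0) (hB : B *ᵥ e = 0) : (a • A + b • B) *ᵥ e = 0 := by
  rw [add_mulVec, smul_mulVec, smul_mulVec, hA, hB, smul_zero, smul_zero, add_zero]

omit [Fintype m] in
/-- RIGHT (column) version: if both `A` and `B` kill the subspace `E` of column vectors, then every member of the pencil
has `rank + dim E ≤ number of columns`.  (Census: `E = I_{t-d}`, so `g ≤ dim R_{t-d} - dim I_{t-d} = r'`.) -/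
theorem rank_add_finrank_le_card_of_mulVec_eq_zero (A B : Matrix m n K) (E : Submodule K (n → K))
    (hA : ∀ e ∈ E, A *ᵥ e = 0) (hB : ∀ e ∈ E, B *ᵥ e = 0) (a b : K) :
    (a • A + b • B).rank + finrank K E ≤ Fintype.card n := by
  set M : Matrix m n K := a • A + b • B with hM
  have hle : E ≤ LinearMap.ker M.mulVecLin := by
    intro e he
    rw [LinearMap.mem_ker, Matrix.mulVecLin_apply]
    exact pencil_mulVec_eq_zero A B a b (hA e he) (hB e he)
  have h1 : finrank K E ≤ finrank K (LinearMap.ker M.mulVecLin) := Submodule.finrank_mono hle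
  have h2 := LinearMap.finrank_range_add_finrank_ker M.mulVecLin
  rw [Module.finrank_fintype_fun_eq_card] at h2
  unfold Matrix.rank
  omega

/-- LEFT (row) version: if the subspace `F` of row vectors kills both `A` and `B` from the left, then every member of the
pencil has `rank + dim F ≤ number of rows`.  (Census: `F = I_d`, so `g ≤ dim R_d - dim I_d = r`, the pair-locus codimension.) -/
theorem rank_add_finrank_le_card_of_vecMul_eq_zero (A B : Matrix m n K) (F : Submodule K (m → K))
    (hA : ∀ f ∈ F, f ᵥ* A = 0) (hB : ∀ f ∈ F, f ᵥ* B = 0) (a b : K) :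
    (a • A + b • B).rank + finrank K F ≤ Fintype.card m := by
  have h := rank_add_finrank_le_card_of_mulVec_eq_zero Aᵀ Bᵀ F
    (fun f hf => by rw [mulVec_transpose]; exact hA f hf) (fun f hf => by rw [mulVec_transpose]; exact hB f hf) a b
  have ht : (a • A + b • B)ᵀ = a • Aᵀ + b • Bᵀ := by
    rw [transpose_add, transpose_smul, transpose_smul]
  rwa [← ht, rank_transpose] at h

/-- Both bounds together: every pencil rank is at most `min (#rows - dim F) (#cols - dim E)`
(census: `g ≤ min (r, r')`, PROPOSITION U of ENGINEB-g30 §3b). -/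
theorem rank_le_min (A B : Matrix m n K) (F : Submodule K (m → K)) (E : Submodule K (n → K))
    (hFA : ∀ f ∈ F, f ᵥ* A = 0) (hFB : ∀ f ∈ F, f ᵥ* B = 0)
    (hEA : ∀ e ∈ E, A *ᵥ e = 0) (hEB : ∀ e ∈ E, B *ᵥ e = 0) (a b : K) :
    (a • A + b • B).rank ≤ min (Fintype.card m - finrank K F) (Fintype.card n - finrank K E) := by
  have h1 := rank_add_finrank_le_card_of_vecMul_eq_zero A B F hFA hFB a b
  have h2 := rank_add_finrank_le_card_of_mulVec_eq_zero A B E hEA hEB a b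
  exact le_min (by omega) (by omega)

/-- The census reading (excess lower bound): with `r := #rows - dim F` (common left kernel `F = I_d`, so `r` = the pair-locus
codimension when `F` is ALL of `I_d`) and `r' := #cols - dim E` (`E = I_{t-d}`), every pencil rank `g` satisfies `r - r' ≤ r - g`,
i.e. the excess `b = r - g` of EVERY member (in particular the generic one) is at least `r - r'`. -/
theorem excess_lower_bound (A B : Matrix m n K) (F : Submodule K (m → K)) (E : Submodule K (n → K))
    (hFA : ∀ f ∈ F, f ᵥ* A = 0) (hFB : ∀ f ∈ F, f ᵥ* B = 0)
    (hEA : ∀ e ∈ E, A *ᵥ e = 0) (hEB : ∀ e ∈ E, B *ᵥ e = 0) (a b : K) :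
    (Fintype.card m - finrank K F) - (Fintype.card n - finrank K E)
      ≤ (Fintype.card m - finrank K F) - (a • A + b • B).rank := by
  have h := rank_le_min A B F E hFA hFB hEA hEB a b
  have h2 : (a • A + b • B).rank ≤ Fintype.card n - finrank K E := le_trans h (min_le_right _ _)
  omega

end Summit.HodgeConjecture.HodgeConjecture.HodgeLocus.Census.DualDegree
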